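import Literature.AnabelianGeometry.EtaleTheta.FrdIVocabulary
import Literature.AnabelianGeometry.EtaleTheta.Discharge.Sec4NonVacuity
import HarnessLib

/-!
# [EtTh] Proposition 4.2 (i), (ii) (`BiKummerSetting.Prop42_i`, `BiKummerSetting.Prop42_ii`):
# the instance form at the canonical [FrdI] vocabulary, and the (negative) universal closure — a schema certificate

S. Mochizuki, *The étale theta function and its Frobenioid-theoretic manifestations*, Publ. RIMS **45**
(2009), §4, Prop. 4.2 (i)(ii), printed p. 314 (PDF p. 88) [cite: MochizukiEtTh2009, Prop 4.2 p.88]: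
"(i) A pair of morphisms `t', t'' : A → C` is a right fraction-pair for `f` if and only if there exists a
[necessarily unique] isomorphism `v : B ⥲ C` such that `t' = v ∘ s'`, `t'' = v ∘ s''`.  (ii) A pair of morphisms
`t', t'' : C → B` is a left fraction-pair for `f|_B` if and only if there exists a [necessarily unique]
isomorphism `v : C ⥲ A` such that `t' = s' ∘ v`, `t'' = s'' ∘ v`."

PROOF-ONLY companion of `BiKummerRoots.lean` (statements, seat abc-iut-L2-t3), abc-iut cell, block F (fact-proving
wave), seat abc-iut-f-108, FACT-LIST rows **F-0488** `BiKummerSetting.Prop42_i` and **F-0489** `BiKummerSetting.Prop42_ii`.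
Both named `Prop`s are typed over the HYPOTHESIS STRUCTURE `S : BiKummerSetting X T D VD` (`BiKummer.lean`), whose
birational vocabulary — `O^×(A^birat)`, the fraction `s' · (s'')⁻¹`, restriction `f ↦ f|_B`, "disjoint supports" —
consists of FREE fields.  Accordingly:

* **Instance form, PROVED with no residual hypothesis**: at abc-iut-L2-t9's canonical model instance
  `BiKummerSetting.mkOfModelCanonical` (birational vocabulary := the model Frobenioid's, [FrdI] Thm. 5.2 (ii);
  disjoint supports := the [FrdI] Prop. 4.1 (iii) predicate) over a tempered Frobenioid typed at the CANONICAL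
  [FrdI] monoid vocabulary `treeMonoidVocab` (`FrdIVocabulary.lean`: "perf-factorial" := the tree's
  `Frobenioids.IsPerfFactorial`), Prop. 4.2 (i) and (ii) hold outright — abc-iut-L6-t12/L2-t9's
  `prop42_i_mkOfModelCanonical` / `prop42_ii_mkOfModelCanonical`, whose only hypothesis "every `Φ(A)` is
  perf-factorial" is then the interface's own field `TemperedFrobenioid.isPerfFactorial` ([EtTh] Def. 3.6 (ii)
  "`Φ` … determines a perf-factorial divisorial monoid on `D`"): `prop42_i_mkOfModelCanonical_treeVocab`,
  `prop42_ii_mkOfModelCanonical_treeVocab`;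
* **the universal closures over an ARBITRARY setting `S` are FALSE**: over abc-iut-L6-t12's perfect toy tempered
  Frobenioid (`Discharge/Sec4NonVacuity.lean`) equip the §4 setting with the TRIVIAL birational vocabulary
  (`O^×(A^birat) := 1`, all fractions and restrictions trivial, all supports "disjoint"); then every base-equivalent
  pair of pre-steps is a fraction-pair for `f = 1`, and the two distinct pre-steps `id`, `(1, id, 𝔭, 1·𝔭) : A_⊙ → A_⊙`
  violate (i) and (ii) (`Toy.exists_biKummerSetting_not_prop42`, `not_forall_prop42_i`, `not_forall_prop42_ii`) —
  while at the canonical instance over the SAME toy both hold (abc-iut-L2-lead's `Toy.prop42_i`, `Toy.prop42_ii`,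
  `Discharge/Sec4NonVacuityPipeline.lean`).

So the two rows are SCHEMATA: facts at the named instance family `mkOfModelCanonical` (proved), never hypotheses
`∀ S, S.Prop42_i` (kernel-false).  Nothing in print is refuted (print's `C` IS the model Frobenioid with its own
birationalization); no statement is restated or strengthened; no new definition, no instance, no `sorry`.
HONEST FRAMING: typed ≠ proved for Prop. 4.2 (iii)(iv); nothing here bears on, or takes a side on, [IUTchIII] Cor. 3.12.
-/

noncomputable section

namespace Literature.AnabelianGeometry.EtaleTheta

open CategoryTheory Opposite Literature.AlgebraicGeometry.Frobenioids
open scoped NNRat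

universe u₀ v₀ u v w

/-! ### Instance form at the canonical [FrdI] monoid vocabulary: no residual hypothesis -/

namespace BiKummerSetting

variable {K : Type u₀} [Field K] (X : SemiGraphs.TemperedArithmeticGroup.{u₀} K) {D₀ : Type u₀}
  [Category.{v₀} D₀] {T : RealifiedDivisorMonoids (D₀ := D₀) treeMonoidVocab.{w}}
  {D : Type u} [Category.{v} D] {VD : FrdICatStub.{u, v, w} D}
  (tf : TemperedFrobenioid T D VD) (hZ : tf.monoidType = MonoidType.Z)
  (hP : ∀ A : Dᵒᵖ, IsPerfect (tf.Φ.carrier A)) (IG : D → Prop) (gS : ∀ A : D, IG A → (X.Pi →* Aut A))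
  (gSs : ∀ (A : D) (h : IG A), Function.Surjective (gS A h))
  (NH : Subgroup (Field.absoluteGaloisGroup K) → tf.category → ℕ+ → Prop) (A₀ : tf.category)
  (hA₀ : PreFrobenioid.IsFrobeniusTrivial tf.toElem A₀) (hA₀' : IG A₀.base)

/-- **[EtTh] Prop. 4.2 (i) at the canonical model instance over the canonical [FrdI] vocabulary — no residual
hypothesis**: for a tempered Frobenioid typed at `treeMonoidVocab` ("perf-factorial" = the tree's notion), the
hypothesis of `prop42_i_mkOfModelCanonical` is the interface field `tf.isPerfFactorial` ([EtTh] Def. 3.6 (ii)).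
[cite: MochizukiEtTh2009, Prop 4.2 p.88] -/
theorem prop42_i_mkOfModelCanonical_treeVocab :
    (mkOfModelCanonical X tf hZ hP IG gS gSs NH A₀ hA₀ hA₀').Prop42_i :=
  prop42_i_mkOfModelCanonical X tf hZ hP IG gS gSs NH A₀ hA₀ hA₀' fun A => tf.isPerfFactorial A

/-- **[EtTh] Prop. 4.2 (ii) at the canonical model instance over the canonical [FrdI] vocabulary — no residual
hypothesis** (necessity and uniqueness, as typed). [cite: MochizukiEtTh2009, Prop 4.2 p.88] -/
theorem prop42_ii_mkOfModelCanonical_treeVocab :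
    (mkOfModelCanonical X tf hZ hP IG gS gSs NH A₀ hA₀ hA₀').Prop42_ii :=
  prop42_ii_mkOfModelCanonical X tf hZ hP IG gS gSs NH A₀ hA₀ hA₀' fun A => tf.isPerfFactorial A

/-- Both at once, universally over the canonical instance family (the form consumers cite BY NAME).
[cite: MochizukiEtTh2009, Prop 4.2 p.88] -/
theorem prop42_i_ii_mkOfModelCanonical_treeVocab :
    (mkOfModelCanonical X tf hZ hP IG gS gSs NH A₀ hA₀ hA₀').Prop42_i ∧
      (mkOfModelCanonical X tf hZ hP IG gS gSs NH A₀ hA₀ hA₀').Prop42_ii :=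
  ⟨prop42_i_mkOfModelCanonical_treeVocab X tf hZ hP IG gS gSs NH A₀ hA₀ hA₀',
    prop42_ii_mkOfModelCanonical_treeVocab X tf hZ hP IG gS gSs NH A₀ hA₀ hA₀'⟩

end BiKummerSetting

/-! ### The universal closures are false (the rows are schemata, not facts) -/

namespace Toy

/-- **Closed witness**: a §4 setting over the perfect toy tempered Frobenioid (`Discharge/Sec4NonVacuity.lean`) with
the TRIVIAL birational vocabulary — `O^×(A^birat) := 1`, every fraction `s'·(s'')⁻¹ := 1`, every restriction the
identity of `1`, "disjoint supports" := always — at which Prop. 4.2 (i) and (ii) both FAIL: the pre-steps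
`s := (1, id, 𝔭, 1·𝔭)` and `id` on `A_⊙ = (∗, 0)` are distinct and base-equivalent, so `(s, id)` and `(id, id)` are
fraction-pairs for `f = 1` with the same codomain not related by any isomorphism `v` with `v ∘ id = id`.
[cite: MochizukiEtTh2009, Prop 4.2 p.88] -/
theorem exists_biKummerSetting_not_prop42 :
    ∃ S : BiKummerSetting temperedGroup realifiedQ (Discrete PUnit.{1}) catVocab,
      ¬ S.Prop42_i ∧ ¬ S.Prop42_ii := by
  -- the generator `𝔭` of `Φ(∗) = ℚ_{≥0}` (multiplicative notation) and the rational function `1·𝔭 = (1, 𝔭) ∈ B(∗)`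
  let p : temperedFrobenioidQ.Φ.carrier (op (ModelFrobenioid.base Aodot)) :=
    ⟨Multiplicative.ofAdd (1 : ℚ≥0), trivial⟩
  have hp : p ≠ 1 := fun h => by
    have h' : (Multiplicative.ofAdd (1 : ℚ≥0) : Multiplicative ℚ≥0) = Multiplicative.ofAdd 0 :=
      congrArg Subtype.val h
    exact one_ne_zero (Multiplicative.ofAdd.injective h')
  have hu : divHomQ (Multiplicative.ofAdd (1 : ℤ)) =
      gpMap (temperedFrobenioidQ.Φ.carrier (op (ModelFrobenioid.base Aodot))).subtype
        (Algebra.GrothendieckGroup.of p) := by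
    rw [divHomQ_ofAdd_one, gpMap_of]
    rfl
  let u : temperedFrobenioidQ.ratFn (op (ModelFrobenioid.base Aodot)) :=
    ⟨(Multiplicative.ofAdd (1 : ℤ), Algebra.GrothendieckGroup.of p), hu⟩
  -- the pre-step `s = (1, id, 𝔭, 1·𝔭) : A_⊙ → A_⊙`, distinct from `id`
  let s : Aodot ⟶ Aodot := ModelFrobenioid.mkHom Aodot Aodot 1 (𝟙 _) p u (by
    rw [PNat.one_coe, pow_one, pullGp_id]
    rfl)
  have hs : PreFrobenioid.IsPreStep temperedFrobenioidQ.toElem s :=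
    ⟨rfl, show IsIso (𝟙 (ModelFrobenioid.base Aodot)) from inferInstance⟩
  have hs1 : s ≠ 𝟙 Aodot := fun h => hp (by
    have h' := congrArg ModelFrobenioid.div h
    rwa [ModelFrobenioid.div_id] at h')
  have haut : ∀ A : Discrete PUnit.{1}, Subsingleton (Aut A) := fun A =>
    ⟨fun _ _ => Iso.ext (Subsingleton.elim _ _)⟩
  -- the §4 setting with trivial birational vocabulary
  let S : BiKummerSetting temperedGroup realifiedQ (Discrete PUnit.{1}) catVocab :=
    { tf := temperedFrobenioidQ
      monoidType_eq := temperedFrobenioidQ_monoidType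
      isPerfect := temperedFrobenioidQ_isPerfect
      DisjointSupports := fun _ _ => True
      biratUnits := fun _ => PUnit.{1}
      biratAut := fun _ => 1
      restrictAlong := fun _ _ => MulEquiv.refl _
      fracOf := fun _ _ _ _ _ => PUnit.unit
      IsGaloisObj := fun _ => True
      galoisSurj := fun _ _ => 1
      galoisSurj_surjective := fun A _ σ => ⟨1, (haut A).elim _ _⟩
      IsNHSaturatedBsFld := fun _ _ _ => True
      ArisesFromBaseFrobeniusPair := fun _ _ _ => True
      Aodot := Aodot
      isFrobeniusTrivial_Aodot := isFrobeniusTrivial_Aodot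
      isGalois_Aodot := trivial }
  -- the two fraction-pairs `(s, id)` and `(id, id)` for `f = 1 ∈ O^×(A_⊙^birat) = 1`, codomain `A_⊙`
  let P : S.FractionPair (A := Aodot) PUnit.unit Aodot :=
    { num := s
      den := 𝟙 _
      isPreStep_num := hs
      isPreStep_den := ModelFrobenioid.isPreStep_id _
      base_eq := rfl
      frac_eq := rfl
      disjointSupports := trivial }
  let Q : S.FractionPair (A := Aodot) PUnit.unit Aodot :=
    { num := 𝟙 _
      den := 𝟙 _
      isPreStep_num := ModelFrobenioid.isPreStep_id _
      isPreStep_den := ModelFrobenioid.isPreStep_id _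
      base_eq := rfl
      frac_eq := rfl
      disjointSupports := trivial }
  refine ⟨S, fun h => hs1 ?_, fun h => hs1 ?_⟩
  · -- (i): `(id, id)` is a fraction-pair, so some `v` has `s ≫ v = id` and `id ≫ v = id`, whence `s = id`
    obtain ⟨v, ⟨h1, h2⟩, -⟩ := (h PUnit.unit P (𝟙 Aodot) (𝟙 Aodot)).1 ⟨Q, rfl, rfl⟩
    have hv : v.hom = 𝟙 Aodot := by
      have h2' : 𝟙 Aodot ≫ v.hom = 𝟙 Aodot := h2
      rwa [Category.id_comp] at h2'
    have h1' : s ≫ v.hom = 𝟙 Aodot := h1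
    rwa [hv, Category.comp_id] at h1'
  · -- (ii): `(s, id)` and `(id, id)` have the same (trivial) restriction, so some `v` has `v ≫ id = s`, `v ≫ id = id`
    obtain ⟨v, ⟨h1, h2⟩, -⟩ := h PUnit.unit Q PUnit.unit P rfl
    have hv : v.hom = 𝟙 Aodot := by
      have h2' : v.hom ≫ 𝟙 Aodot = 𝟙 Aodot := h2
      rwa [Category.comp_id] at h2'
    have h1' : v.hom ≫ 𝟙 Aodot = s := h1
    rw [hv, Category.comp_id] at h1'
    exact h1'.symm

end Toy

/-- **The universal closure of `Prop42_i` over arbitrary §4 settings is false** (FACT-LIST row F-0488 is a SCHEMA: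
a fact at the canonical model instance `mkOfModelCanonical` — `prop42_i_mkOfModelCanonical_treeVocab` — never the
hypothesis `∀ S, S.Prop42_i`): quantified over all settings (universe `0`), it fails at the toy setting with
trivial birational vocabulary. [cite: MochizukiEtTh2009, Prop 4.2 p.88] -/
theorem not_forall_prop42_i :
    ¬ ∀ (K : Type) [Field K] (X : SemiGraphs.TemperedArithmeticGroup.{0} K) (D₀ : Type) [Category.{0} D₀]
        (V : FrdIMonoidStub.{0}) (T : RealifiedDivisorMonoids (D₀ := D₀) V) (D : Type) [Category.{0} D]
        (VD : FrdICatStub.{0, 0, 0} D) (S : BiKummerSetting X T D VD), S.Prop42_i := by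
  intro h
  obtain ⟨S, hS, -⟩ := Toy.exists_biKummerSetting_not_prop42
  exact hS (h _ _ _ _ _ _ _ S)

/-- **The universal closure of `Prop42_ii` over arbitrary §4 settings is false** (FACT-LIST row F-0489 is a SCHEMA:
a fact at the canonical model instance — `prop42_ii_mkOfModelCanonical_treeVocab` — never the hypothesis
`∀ S, S.Prop42_ii`). [cite: MochizukiEtTh2009, Prop 4.2 p.88] -/
theorem not_forall_prop42_ii :
    ¬ ∀ (K : Type) [Field K] (X : SemiGraphs.TemperedArithmeticGroup.{0} K) (D₀ : Type) [Category.{0} D₀]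
        (V : FrdIMonoidStub.{0}) (T : RealifiedDivisorMonoids (D₀ := D₀) V) (D : Type) [Category.{0} D]
        (VD : FrdICatStub.{0, 0, 0} D) (S : BiKummerSetting X T D VD), S.Prop42_ii := by
  intro h
  obtain ⟨S, -, hS⟩ := Toy.exists_biKummerSetting_not_prop42
  exact hS (h _ _ _ _ _ _ _ S)

end Literature.AnabelianGeometry.EtaleTheta

end
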